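import Mathlib
import HarnessLib
import Summits.ValiantsHypothesis.ValiantsHypothesis.Theses.MonotoneRestoration
import Literature.Computability.AlgebraicComplexity.ArithCircuit
import Literature.Computability.AlgebraicComplexity.ArithCircuitProofs
import Literature.Computability.AlgebraicComplexity.MonotoneStructure
import Literature.Computability.AlgebraicComplexity.PermanentIrreducible
import Literature.ModelTheory.FiniteModelTheory.CkEquiv
import Summits.ValiantsHypothesis.ValiantsHypothesis.Theorems.MonotoneRestorationMonotoneRestorationQPCosetCount
import Summits.ValiantsHypothesis.ValiantsHypothesis.Theorems.MonotoneRestorationMonotoneRestorationQPSymmetricLB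
import Summits.ValiantsHypothesis.ValiantsHypothesis.Theorems.MonotoneRestorationMonotoneRestorationQPSupportSymmetrisation
import Summits.ValiantsHypothesis.ValiantsHypothesis.Theorems.MonotoneRestorationMonotoneRestorationQPSparseRegime
import Summits.ValiantsHypothesis.ValiantsHypothesis.Theorems.MonotoneRestorationMonotoneRestorationQPBeta
import Literature.Computability.AlgebraicComplexity.SymmetricArithCircuit
import Literature.Computability.AlgebraicComplexity.DawarWilsenach2025Proofs
import Literature.GroupTheory.PermutationGroups.SmallIndexSubgroups
import Summits.ValiantsHypothesis.ValiantsHypothesis.Theorems.MonotoneRestorationQP.Negative.LoadBearing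
import Summits.ValiantsHypothesis.ValiantsHypothesis.Theorems.MonotoneRestorationMonotoneRestorationQPPermSupportCount
import Summits.ValiantsHypothesis.ValiantsHypothesis.Theorems.MonotoneRestorationMonotoneRestorationQPVariants19213

/-! TTRL-lite variant V19145 of stmt-ValiantsHypothesis-15886 -/

-- `Summit.ValiantsHypothesis.ValiantsHypothesis.…` is the tree's mandated single-conjunct layout
-- (Sub = Summit), so the duplicated namespace component is intended.
set_option linter.dupNamespace false

namespace Summit.ValiantsHypothesis.ValiantsHypothesis.Theorems

open Summit.ValiantsHypothesis.ValiantsHypothesis.Theses.MonotoneRestoration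
open Literature.Computability.AlgebraicComplexity

/-- **TTRL-lite variant V19145 (boundary probe, FALSE)** of `stub_esymmRowSums_structure`
(`stmt-ValiantsHypothesis-15886`): the row-sum substitution `e₂(R₀, R₁, R₂, R₃)`
(`Rᵢ = ∑ j, X (i, j)`) of `esymm (Fin 4) ℝ≥0 (4 / 2)` is row-multilinear but NOT
column-multilinear.  Witness: the monomial `X (0,0) * X (1,0)` (rows `0` and `1`, both in
column `0`) has coefficient `1` (`stub_esymmRowSums_structure_var19213`, the `R₀ R₁` term), hence
lies in the support, and its column-`0` degree `Finsupp.mapDomain Prod.snd m 0` is `2 > 1`.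
(Column-multilinearity of `e_k` of the row sums holds only for `k ≤ 1`, i.e. `n ≤ 3`.)
[folklore] -/
theorem stub_esymmRowSums_structure_var19145_false :
    ¬ (∀ m ∈ (MvPolynomial.bind₁ (fun i : Fin 4 => ∑ j : Fin 4, MvPolynomial.X (i, j))
        (MvPolynomial.esymm (Fin 4) NNReal (4 / 2))).support,
        ∀ j : Fin 4, Finsupp.mapDomain Prod.snd m j ≤ 1) := by
  intro h
  -- the witness monomial `X (0,0) * X (1,0)` lies in the support (coefficient `1`)
  have hmem : (Finsupp.single ((0 : Fin 4), (0 : Fin 4)) 1 + Finsupp.single ((1 : Fin 4), (0 : Fin 4)) 1)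
      ∈ (MvPolynomial.bind₁ (fun i : Fin 4 => ∑ j : Fin 4, MvPolynomial.X (i, j))
        (MvPolynomial.esymm (Fin 4) NNReal (4 / 2))).support := by
    have h42 : (4 / 2 : ℕ) = 2 := rfl
    rw [MvPolynomial.mem_support_iff, h42, stub_esymmRowSums_structure_var19213]
    exact one_ne_zero
  -- but its column-`0` degree is `2`
  have h2 := h _ hmem 0
  rw [Finsupp.mapDomain_add, Finsupp.mapDomain_single, Finsupp.mapDomain_single,
    Finsupp.add_apply, Finsupp.single_eq_same] at h2
  omega

end Summit.ValiantsHypothesis.ValiantsHypothesis.Theorems
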